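import Literature.GroupTheory.FiniteAbelian.MaximalOrderSummand
import Mathlib.Algebra.Module.Injective
import Mathlib.Algebra.Module.ZMod
import Mathlib.Data.ZMod.QuotientGroup
import Mathlib.GroupTheory.OrderOfElement
import HarnessLib

/-!
# Crux U1 `KolyvaginBoundedDefectAtTwo` (stmt-BirchSwinnertonDyer-28083), LINE 17 `regular_core_rigidity` v3,
# stub S1b `stub_nearCoreExistenceAtTwo` — WALK ALGEBRA I: characters `χ : G → ℤ/m` of an `m`-torsion abelian
# group taking two given elements to values of FULL order (the walk's choice of `α` at each regular step)

Width seat `bsd-line-krr2-p2` g14 (ONE READER on S1b); `--supports stmt-BirchSwinnertonDyer-28083` (helper). THEOREMS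
ONLY (finite-group algebra); nothing here proves S1b, U1, a rung or BSD. BSD is NOT proved.

## Why
A regular step of the walk (reader report S1-READER-g14 §4) feeds the value engine
(`RegularValueEngine.exists_regular_kolyvaginPrime_values_of_heegner`, p682314 + sequel) a CHARACTER `α` of the
restricted span `res(S)` with: `α = 0` on the frame elements that must survive (`x₀` and `F ∖ {p, q}`), and
`α(p̄)`, `α(q̄)` of FULL order in the quotient (so that the cut `#loc_v(S) ≥ 2^(a+b−1)`). This file supplies that
character: on an `m`-torsion abelian group every element `y` admits `χ : G →+ ℤ/m` with `ord χ(y) = ord y`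
(`ℤ/m` is self-injective — the tree's `Literature.GroupTheory.FiniteAbelian.zmod_injective` — so the obvious
character of the `a`-torsion subgroup through `y` extends), and for `m = 2^k` two elements at once (the
characters failing at `yᵢ` form a proper subgroup, and a group is not the union of two proper subgroups).

## What (all PROVED; no definition, no named fact, no `sorry`)
* `exists_not_mem_and_not_mem` — an (additive) group is not the union of two proper subgroups;
* `exists_addMonoidHom_zmod_addOrderOf_eq` — `mG = 0`, `y ∈ G` ⟹ `∃ χ : G →+ ZMod m, addOrderOf (χ y) = addOrderOf y`;
* `addOrderOf_apply_eq_iff_of_prime_pow` — for `ord y = 2^e`, `e ≠ 0`: `ord χ(y) = ord y ↔ χ (2^(e−1) • y) ≠ 0`;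
* **`exists_addMonoidHom_zmod_pow_addOrderOf_eq_pair`** — `2^k G = 0`, `y₁ y₂ ∈ G` ⟹ one `χ : G →+ ZMod (2^k)` with
  `addOrderOf (χ yᵢ) = addOrderOf yᵢ` for `i = 1, 2`.
References: [cite: Hungerford1974, Ch. IV §6 Exercise 7 (d)–(e)] for self-injectivity; the rest [folklore].
Design: no definitions; `Type*`-polymorphic; axioms `propext`, `Classical.choice`, `Quot.sound`.
-/

set_option autoImplicit false
-- the Theorems namespace of this sub repeats the summit name by design (D-0017 nested layout)
set_option linter.dupNamespace false

noncomputable section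

open scoped Classical

namespace Summit.BirchSwinnertonDyer.BirchSwinnertonDyer.Theorems.KolyvaginAtTwo.WalkAlgebra

open Literature.GroupTheory.FiniteAbelian (zmod_injective exists_addMonoidHom_zmod_apply_eq_one)

/-! ### §1 A group is not the union of two proper subgroups -/

/-- An additive group is not the union of two proper subgroups: if `a ∉ H₁`, `b ∉ H₂`, then one of `a`, `b`,
`a + b` lies outside both. [folklore] -/
theorem exists_not_mem_and_not_mem {G : Type*} [AddCommGroup G] {H₁ H₂ : AddSubgroup G}
    (h₁ : ∃ a, a ∉ H₁) (h₂ : ∃ b, b ∉ H₂) : ∃ g : G, g ∉ H₁ ∧ g ∉ H₂ := by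
  obtain ⟨a, ha⟩ := h₁
  obtain ⟨b, hb⟩ := h₂
  by_cases ha2 : a ∈ H₂
  · by_cases hb1 : b ∈ H₁
    · refine ⟨a + b, fun h ↦ ha ?_, fun h ↦ hb ?_⟩
      · have := H₁.sub_mem h hb1; rwa [add_sub_cancel_right] at this
      · have := H₂.sub_mem h ha2; rwa [add_sub_cancel_left] at this
    · exact ⟨b, hb1, hb⟩
  · exact ⟨a, ha, ha2⟩

/-! ### §2 One element: a character of full order on `y` -/

/-- **On an `m`-torsion abelian group every element is detected with its full order by a character into `ℤ/m`**:
`∃ χ : G →+ ZMod m, addOrderOf (χ y) = addOrderOf y`. PROOF: `a := ord y ∣ m`; on the `a`-torsion subgroup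
`G[a] ∋ y` the tree's `exists_addMonoidHom_zmod_apply_eq_one` gives `χ₀ : G[a] → ℤ/a` with `χ₀ y = 1`; compose with
`ℤ/a ↪ ℤ/m`, `1 ↦ m/a` (an element of order `a`), and extend to `G` by the self-injectivity of `ℤ/m`
(`zmod_injective`, Baer). [cite: Hungerford1974, Ch. IV §6 Exercise 7 (d)–(e) (PDF p. 308)] -/
theorem exists_addMonoidHom_zmod_addOrderOf_eq {G : Type*} [AddCommGroup G] {m : ℕ} [NeZero m]
    (hG : ∀ g : G, m • g = 0) (y : G) :
    ∃ χ : G →+ ZMod m, addOrderOf (χ y) = addOrderOf y := by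
  set a := addOrderOf y with ha
  have hfin : IsOfFinAddOrder y := isOfFinAddOrder_iff_nsmul_eq_zero.mpr ⟨m, NeZero.pos m, hG y⟩
  have ha0 : a ≠ 0 := hfin.addOrderOf_pos.ne'
  haveI : NeZero a := ⟨ha0⟩
  have ham : a ∣ m := addOrderOf_dvd_of_nsmul_eq_zero (hG y)
  obtain ⟨q, hq⟩ := ham
  -- the `a`-torsion subgroup `Ga ∋ y`
  set Ga : AddSubgroup G := (nsmulAddMonoidHom a : G →+ G).ker with hGa
  have hGa_mem : ∀ g : G, g ∈ Ga ↔ a • g = 0 := fun g ↦ by rw [hGa, AddMonoidHom.mem_ker]; rfl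
  have hy : y ∈ Ga := (hGa_mem y).mpr (addOrderOf_nsmul_eq_zero y)
  have hGa_tors : ∀ g : Ga, a • g = 0 := fun g ↦ Subtype.ext (by
    rw [AddSubgroupClass.coe_nsmul]; exact (hGa_mem g.1).mp g.2)
  have hord : addOrderOf (⟨y, hy⟩ : Ga) = a := by
    rw [← addOrderOf_injective Ga.subtype Ga.subtype_injective ⟨y, hy⟩]; rfl
  obtain ⟨χ₀, hχ₀⟩ := exists_addMonoidHom_zmod_apply_eq_one hGa_tors hord
  -- `ι : ℤ/a → ℤ/m`, `1 ↦ q = m/a`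
  set f : ℤ →+ ZMod m := (AddMonoidHom.mulRight ((q : ℕ) : ZMod m)).comp (Int.castAddHom (ZMod m)) with hf
  have hf_apply : ∀ z : ℤ, f z = (z : ZMod m) * (q : ZMod m) := fun z ↦ rfl
  have hfa : f (a : ℤ) = 0 := by
    rw [hf_apply, Int.cast_natCast, ← Nat.cast_mul, ← hq, ZMod.natCast_self]
  set ι : ZMod a →+ ZMod m := ZMod.lift a ⟨f, hfa⟩ with hι
  have hι1 : ι 1 = (q : ZMod m) := by
    have h := ZMod.lift_coe a ⟨f, hfa⟩ 1
    rw [Int.cast_one] at h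
    rw [hι, h]
    change f 1 = _
    rw [hf_apply, Int.cast_one, one_mul]
  have hordq : addOrderOf ((q : ℕ) : ZMod m) = a := by
    rw [ZMod.addOrderOf_coe _ (NeZero.ne m), hq, Nat.gcd_mul_left_left, Nat.mul_div_cancel _ (by
      rcases Nat.eq_zero_or_pos q with h | h
      · exfalso; exact NeZero.ne m (by rw [hq, h, mul_zero])
      · exact h)]
  -- extend `ι ∘ χ₀` from `Ga` to `G` (`ℤ/m` is self-injective)
  letI : Module (ZMod m) G := AddCommGroup.zmodModule hG
  have hGa_tors' : ∀ g : Ga, m • g = 0 := fun g ↦ Subtype.ext (by rw [AddSubgroupClass.coe_nsmul, hG]; rfl)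
  letI : Module (ZMod m) Ga := AddCommGroup.zmodModule hGa_tors'
  set ψ : Ga →+ ZMod m := ι.comp χ₀ with hψ
  have hB : Module.Baer (ZMod m) (ZMod m) := Module.Baer.of_injective (zmod_injective m)
  obtain ⟨χ, hχ⟩ := hB.extension_property (Ga.subtype.toZModLinearMap m) Ga.subtype_injective
    (ψ.toZModLinearMap m)
  refine ⟨χ.toAddMonoidHom, ?_⟩
  have h := LinearMap.congr_fun hχ ⟨y, hy⟩
  simp only [LinearMap.coe_comp, Function.comp_apply, AddMonoidHom.coe_toZModLinearMap,
    AddSubgroup.coe_subtype] at h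
  rw [LinearMap.toAddMonoidHom_coe, h, hψ, AddMonoidHom.comp_apply, hχ₀, hι1, hordq]

/-! ### §3 Two elements (`m = 2^k`) -/

/-- For `y` of order `2^e` (`e ≠ 0`) and any character `χ` (into a `2^k`-torsion target... any additive group):
`addOrderOf (χ y) = 2^e ↔ χ (2^(e−1) • y) ≠ 0`. [folklore] -/
theorem addOrderOf_apply_eq_iff_of_prime_pow {G H : Type*} [AddCommGroup G] [AddCommGroup H] (χ : G →+ H)
    {y : G} {e : ℕ} (he : e ≠ 0) (hy : addOrderOf y = 2 ^ e) :
    addOrderOf (χ y) = 2 ^ e ↔ χ (2 ^ (e - 1) • y) ≠ 0 := by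
  have hdvd : addOrderOf (χ y) ∣ 2 ^ e := by rw [← hy]; exact addOrderOf_map_dvd χ y
  obtain ⟨j, hj, hje⟩ := (Nat.dvd_prime_pow Nat.prime_two).mp hdvd
  rw [map_nsmul, hje]
  constructor
  · intro h hzero
    have h1 : 2 ^ j ∣ 2 ^ (e - 1) := by
      rw [← hje]; exact addOrderOf_dvd_of_nsmul_eq_zero hzero
    have h2 : j ≤ e - 1 := (Nat.pow_dvd_pow_iff_le_right one_lt_two).mp h1
    have h3 : j = e := Nat.pow_right_injective le_rfl h
    omega
  · intro h
    by_contra hne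
    have hlt : j < e := lt_of_le_of_ne hj (fun h' ↦ hne (by rw [h']))
    apply h
    have h1 : 2 ^ j ∣ 2 ^ (e - 1) := pow_dvd_pow 2 (by omega)
    obtain ⟨c, hc⟩ := h1
    rw [hc, mul_comm, mul_nsmul, ← hje, smul_comm, addOrderOf_nsmul_eq_zero, nsmul_zero]

/-- **Two elements at once.** If `2^k G = 0` and `y₁, y₂ ∈ G`, there is ONE character `χ : G →+ ℤ/2^k` with
`addOrderOf (χ y₁) = addOrderOf y₁` and `addOrderOf (χ y₂) = addOrderOf y₂`: the characters failing at `yᵢ`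
(`χ (2^(eᵢ−1) yᵢ) = 0`) form a subgroup, proper by §2, and the character group is not the union of two proper
subgroups (§1). [folklore] -/
theorem exists_addMonoidHom_zmod_pow_addOrderOf_eq_pair {G : Type*} [AddCommGroup G] {k : ℕ}
    (hG : ∀ g : G, 2 ^ k • g = 0) (y₁ y₂ : G) :
    ∃ χ : G →+ ZMod (2 ^ k), addOrderOf (χ y₁) = addOrderOf y₁ ∧ addOrderOf (χ y₂) = addOrderOf y₂ := by
  haveI : NeZero (2 ^ k) := ⟨pow_ne_zero k two_ne_zero⟩
  -- trivial cases
  by_cases h1 : y₁ = 0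
  · obtain ⟨χ, hχ⟩ := exists_addMonoidHom_zmod_addOrderOf_eq hG y₂
    exact ⟨χ, by rw [h1, map_zero, addOrderOf_zero, addOrderOf_zero], hχ⟩
  by_cases h2 : y₂ = 0
  · obtain ⟨χ, hχ⟩ := exists_addMonoidHom_zmod_addOrderOf_eq hG y₁
    exact ⟨χ, hχ, by rw [h2, map_zero, addOrderOf_zero, addOrderOf_zero]⟩
  -- orders are powers of two with positive exponent
  have hpow : ∀ y : G, y ≠ 0 → ∃ e : ℕ, e ≠ 0 ∧ addOrderOf y = 2 ^ e := fun y hy ↦ by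
    have hdvd : addOrderOf y ∣ 2 ^ k := addOrderOf_dvd_of_nsmul_eq_zero (hG y)
    obtain ⟨e, -, he⟩ := (Nat.dvd_prime_pow Nat.prime_two).mp hdvd
    refine ⟨e, fun he0 ↦ hy ?_, he⟩
    rw [he0, pow_zero] at he
    exact AddMonoid.addOrderOf_eq_one_iff.mp he
  obtain ⟨e₁, he₁0, he₁⟩ := hpow y₁ h1
  obtain ⟨e₂, he₂0, he₂⟩ := hpow y₂ h2
  -- the "bad" subgroups
  set B₁ : AddSubgroup (G →+ ZMod (2 ^ k)) := (AddMonoidHom.eval (2 ^ (e₁ - 1) • y₁)).ker with hB₁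
  set B₂ : AddSubgroup (G →+ ZMod (2 ^ k)) := (AddMonoidHom.eval (2 ^ (e₂ - 1) • y₂)).ker with hB₂
  have hB₁mem : ∀ χ : G →+ ZMod (2 ^ k), χ ∈ B₁ ↔ χ (2 ^ (e₁ - 1) • y₁) = 0 := fun χ ↦ by
    rw [hB₁, AddMonoidHom.mem_ker]; rfl
  have hB₂mem : ∀ χ : G →+ ZMod (2 ^ k), χ ∈ B₂ ↔ χ (2 ^ (e₂ - 1) • y₂) = 0 := fun χ ↦ by
    rw [hB₂, AddMonoidHom.mem_ker]; rfl
  obtain ⟨χ₁, hχ₁⟩ := exists_addMonoidHom_zmod_addOrderOf_eq hG y₁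
  obtain ⟨χ₂, hχ₂⟩ := exists_addMonoidHom_zmod_addOrderOf_eq hG y₂
  rw [he₁] at hχ₁
  rw [he₂] at hχ₂
  have hn₁ : χ₁ ∉ B₁ := fun h ↦
    ((addOrderOf_apply_eq_iff_of_prime_pow χ₁ he₁0 he₁).mp hχ₁) ((hB₁mem χ₁).mp h)
  have hn₂ : χ₂ ∉ B₂ := fun h ↦
    ((addOrderOf_apply_eq_iff_of_prime_pow χ₂ he₂0 he₂).mp hχ₂) ((hB₂mem χ₂).mp h)
  obtain ⟨χ, hχB₁, hχB₂⟩ := exists_not_mem_and_not_mem (H₁ := B₁) (H₂ := B₂) ⟨χ₁, hn₁⟩ ⟨χ₂, hn₂⟩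
  refine ⟨χ, ?_, ?_⟩
  · rw [he₁]
    exact (addOrderOf_apply_eq_iff_of_prime_pow χ he₁0 he₁).mpr (fun h ↦ hχB₁ ((hB₁mem χ).mpr h))
  · rw [he₂]
    exact (addOrderOf_apply_eq_iff_of_prime_pow χ he₂0 he₂).mpr (fun h ↦ hχB₂ ((hB₂mem χ).mpr h))

end Summit.BirchSwinnertonDyer.BirchSwinnertonDyer.Theorems.KolyvaginAtTwo.WalkAlgebra

end
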